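import Literature.AlgebraicGeometry.Morphisms.FiniteEtaleGeometricFibreCard
import Literature.AlgebraicGeometry.Morphisms.SectionEqualizerClopen
import Literature.AlgebraicGeometry.Morphisms.LocallyNoetherianLocallyConnected
import Mathlib.AlgebraicGeometry.Morphisms.UniversallyOpen
import HarnessLib

/-!
# Geometric points lift along finite étale surjections; a connected component of a finite étale cover of a connected base

Layer `Literature/AlgebraicGeometry/Morphisms`, namespace `Literature.AlgebraicGeometry.Morphisms`.  Cell `hodgecm-mathlib`
(D-0151), F-DAG (h9-S) (W3) / F-10 (b) consumers (author B-p02 (g12)); count-neutral capital, PROOF lane, theorems only.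
HC_CM is proved only modulo the 7 printed citations until rung 0 closes; this file asserts nothing about HC.

## What is proved

* `exists_specOver_of_surjective` — for `q : G → S` finite étale and SURJECTIVE, every geometric point `s̄ : Spec Ω → S`
  (`Ω` separably closed) lifts: `∃ x : Spec Ω → G, x ≫ q = s̄` (the number of lifts is the degree, ★
  `natCard_specOver_eq_finrank`, which is `≥ 1` at every point, Mathlib `Scheme.Hom.one_le_finrank_iff_surjective`);
* `isClopen_image_of_isClopen` — a finite étale morphism maps clopen sets to clopen sets (étale ⇒ universally open,
  finite ⇒ universally closed);
* **`exists_clopen_connected_component_surjective_of_mem`** — for `q : G → S` finite étale over a PRECONNECTED `S`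
  with `G` locally connected (e.g. locally Noetherian, ★ `locallyConnectedSpace_of_isLocallyNoetherian`) and a point
  `x₀ ∈ G`, the connected component of `x₀` is an open-and-closed subscheme which is finite étale AND SURJECTIVE over `S`
  (one point suffices); `exists_clopen_connected_component_surjective` (`q` surjective, `S` non-empty) and
  `…_of_isLocallyNoetherian` — the locally Noetherian form.
  (Used to replace a finite étale cover by a CONNECTED one, e.g. the cover of level-`M` bases in the transport of
  symplectic level structures along a connected base.)

## References
* [GortzWedhorn2020] U. Görtz, T. Wedhorn, *Algebraic Geometry I*, 2nd ed. (2020), Prop. 12.21 and (12.6.1) (degree of a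
  finite locally free morphism and its fibres); Section (4.7), (4.7.1) (p. 108).
* [GortzWedhorn2023] U. Görtz, T. Wedhorn, *Algebraic Geometry II* (2023), Def. 18.34 (étale morphisms; open).
-/

noncomputable section

universe u

open CategoryTheory CategoryTheory.Limits AlgebraicGeometry TopologicalSpace

namespace Literature.AlgebraicGeometry.Morphisms

variable {G S : Scheme.{u}} (q : G ⟶ S) [IsFinite q] [Etale q]

/-- **Geometric points lift along finite étale surjections**: for `q : G → S` finite étale and surjective and a geometric
point `s̄ : Spec Ω → S` (`Ω` separably closed) there is `x : Spec Ω → G` with `x ≫ q = s̄` — the geometric fibre has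
`q.finrank (s̄ ⋆) ≥ 1` points (★ `natCard_specOver_eq_finrank`, Mathlib `Scheme.Hom.one_le_finrank_iff_surjective`).
[cite: GortzWedhorn2020, Prop. 12.21] [cite: GortzWedhorn2020, (12.6.1)] -/
theorem exists_specOver_of_surjective [Surjective q] {Ω : Type u} [Field Ω] [IsSepClosed Ω] (s : Spec (.of Ω) ⟶ S) :
    ∃ x : Spec (.of Ω) ⟶ G, x ≫ q = s := by
  haveI := finite_specOver q s
  have h1 : 1 ≤ Nat.card {x : Spec (.of Ω) ⟶ G // x ≫ q = s} := by
    rw [natCard_specOver_eq_finrank q s]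
    exact (q.one_le_finrank_iff_surjective.mpr ‹Surjective q›) _
  obtain ⟨⟨x, hx⟩⟩ := (Nat.card_pos_iff.mp h1).1
  exact ⟨x, hx⟩

omit [IsFinite q] [Etale q] in
/-- A finite étale (more generally universally open and universally closed) morphism maps clopen sets to clopen sets.
[cite: GortzWedhorn2023, Def. 18.34] [cite: GortzWedhorn2020, Prop. 12.21] -/
theorem isClopen_image_of_isClopen [UniversallyOpen q] [UniversallyClosed q] {U : Set G} (hU : IsClopen U) :
    IsClopen (q.base '' U) :=
  ⟨q.isClosedMap _ hU.1, q.isOpenMap _ hU.2⟩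

/-- **A connected component of a finite étale `S`-scheme over a connected base is a finite étale COVER.**  For
`q : G → S` finite étale with `S` preconnected, `G` locally connected and `x₀ ∈ G`, the connected component `U` of `x₀` is
an open-and-closed subscheme (Mathlib `isClopen_connectedComponent`) with `U → S` finite étale (★
`isFinite_and_etale_ι_of_isClosed`) and SURJECTIVE: its image is open (étale), closed (finite) and non-empty, hence all
of `S`.  (No surjectivity of `q` is assumed: ONE point of `G` suffices.) [cite: GortzWedhorn2023, Def. 18.34]
[cite: GortzWedhorn2020, Prop. 12.21] -/
theorem exists_clopen_connected_component_surjective_of_mem [PreconnectedSpace S] [LocallyConnectedSpace G] (x₀ : G) :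
    ∃ U : G.Opens, x₀ ∈ U ∧ IsClosed (U : Set G) ∧ ConnectedSpace (U : Scheme.{u}) ∧ IsFinite (U.ι ≫ q) ∧
      Etale (U.ι ≫ q) ∧ Surjective (U.ι ≫ q) := by
  let U : G.Opens := ⟨connectedComponent x₀, isOpen_connectedComponent⟩
  have hUc : IsClosed (U : Set G) := isClosed_connectedComponent
  haveI : ConnectedSpace (U : Scheme.{u}) := Subtype.connectedSpace isConnected_connectedComponent
  obtain ⟨hfin, het⟩ := isFinite_and_etale_ι_of_isClosed U hUc
  haveI := hfin
  haveI := het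
  refine ⟨U, mem_connectedComponent, hUc, inferInstance, inferInstance, inferInstance, ⟨?_⟩⟩
  -- the image of `U` is clopen and non-empty, hence everything
  have himg : Set.range (U.ι ≫ q).base = q.base '' (U : Set G) := by
    rw [Scheme.Hom.comp_base, TopCat.coe_comp, Set.range_comp, Scheme.Opens.range_ι]
  have hclopen : IsClopen (Set.range (U.ι ≫ q).base) := by
    rw [himg]
    exact isClopen_image_of_isClopen q ⟨hUc, U.2⟩
  have hne : (Set.range (U.ι ≫ q).base).Nonempty := by
    rw [himg]
    exact ⟨q.base x₀, x₀, mem_connectedComponent, rfl⟩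
  have huniv : Set.range (U.ι ≫ q).base = Set.univ := (isClopen_iff.mp hclopen).resolve_left hne.ne_empty
  exact Set.range_eq_univ.mp huniv

/-- **A connected component of a finite étale cover of a connected base is a finite étale cover.**  For `q : G → S`
finite étale surjective with `S` preconnected and non-empty and `G` locally connected, some connected component `U` of
`G` is an open-and-closed subscheme with `U → S` finite étale and surjective. [cite: GortzWedhorn2023, Def. 18.34]
[cite: GortzWedhorn2020, Prop. 12.21] -/
theorem exists_clopen_connected_component_surjective [Surjective q] [PreconnectedSpace S] [Nonempty S]
    [LocallyConnectedSpace G] :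
    ∃ U : G.Opens, IsClosed (U : Set G) ∧ ConnectedSpace (U : Scheme.{u}) ∧ IsFinite (U.ι ≫ q) ∧ Etale (U.ι ≫ q) ∧
      Surjective (U.ι ≫ q) := by
  obtain ⟨s₀⟩ := ‹Nonempty S›
  obtain ⟨x₀, -⟩ := ‹Surjective q›.surj s₀
  obtain ⟨U, -, h⟩ := exists_clopen_connected_component_surjective_of_mem q x₀
  exact ⟨U, h⟩

/-- Geometric points of `S` lift to the connected component (it is finite étale surjective).
[cite: GortzWedhorn2020, Prop. 12.21] -/
theorem exists_specOver_comp_of_surjective (U : G.Opens) [Surjective (U.ι ≫ q)] (hU : IsClosed (U : Set G))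
    {Ω : Type u} [Field Ω] [IsSepClosed Ω] (s : Spec (.of Ω) ⟶ S) :
    ∃ x : Spec (.of Ω) ⟶ (U : Scheme.{u}), x ≫ U.ι ≫ q = s := by
  obtain ⟨hfin, het⟩ := isFinite_and_etale_ι_of_isClosed U hU
  haveI := hfin
  haveI := het
  obtain ⟨x, hx⟩ := exists_specOver_of_surjective (U.ι ≫ q) s
  exact ⟨x, hx⟩

/-- **Locally Noetherian form (one point).**  For `q : G → S` finite étale over a PRECONNECTED, locally Noetherian `S`
and `x₀ ∈ G`, the connected component of `x₀` is an open-and-closed subscheme, finite étale and SURJECTIVE over `S`: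
`G` is locally Noetherian (Mathlib `LocallyOfFiniteType.isLocallyNoetherian`), hence locally connected (★
`locallyConnectedSpace_of_isLocallyNoetherian`), and `exists_clopen_connected_component_surjective_of_mem` applies.
[cite: GortzWedhorn2023, Def. 18.34] [cite: GortzWedhorn2020, Prop. 12.21] -/
theorem exists_clopen_connected_component_surjective_of_mem_of_isLocallyNoetherian [PreconnectedSpace S]
    [IsLocallyNoetherian S] (x₀ : G) :
    ∃ U : G.Opens, x₀ ∈ U ∧ IsClosed (U : Set G) ∧ ConnectedSpace (U : Scheme.{u}) ∧ IsFinite (U.ι ≫ q) ∧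
      Etale (U.ι ≫ q) ∧ Surjective (U.ι ≫ q) := by
  haveI : IsLocallyNoetherian G := LocallyOfFiniteType.isLocallyNoetherian q
  haveI := locallyConnectedSpace_of_isLocallyNoetherian G
  exact exists_clopen_connected_component_surjective_of_mem q x₀

/-- **Locally Noetherian form.**  For `q : G → S` finite étale surjective over a preconnected, non-empty, locally
Noetherian `S`, some connected component `U` of `G` is an open-and-closed subscheme with `U → S` finite étale and
surjective (`G` is locally Noetherian, Mathlib `LocallyOfFiniteType.isLocallyNoetherian`, hence locally connected, ★
`locallyConnectedSpace_of_isLocallyNoetherian`). [cite: GortzWedhorn2023, Def. 18.34] [cite: GortzWedhorn2020, Prop. 12.21] -/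
theorem exists_clopen_connected_component_surjective_of_isLocallyNoetherian [Surjective q] [PreconnectedSpace S]
    [Nonempty S] [IsLocallyNoetherian S] :
    ∃ U : G.Opens, IsClosed (U : Set G) ∧ ConnectedSpace (U : Scheme.{u}) ∧ IsFinite (U.ι ≫ q) ∧ Etale (U.ι ≫ q) ∧
      Surjective (U.ι ≫ q) := by
  haveI : IsLocallyNoetherian G := LocallyOfFiniteType.isLocallyNoetherian q
  haveI := locallyConnectedSpace_of_isLocallyNoetherian G
  exact exists_clopen_connected_component_surjective q

end Literature.AlgebraicGeometry.Morphisms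

end
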